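import Literature.Computability.AlgebraicComplexity.QuantumFunctionalPointProofs
import Literature.Computability.AlgebraicComplexity.QuantumFunctionalsDirectSumSubadditive
import Literature.Computability.AlgebraicComplexity.QuantumFunctionalsUpperSubmultiplicativeProofs
import HarnessLib

/-!
# The quantum functionals are universal spectral points — discharge of
# `ChristandlVranaZuiddam2023_mem_asymptoticSpectrum` (CVZ Cor. 3.31)

Topic `Literature/Computability/AlgebraicComplexity`; proofs file (theorems only) closing the named
fact `ChristandlVranaZuiddam2023_mem_asymptoticSpectrum` of `QuantumFunctionalPoint.lean`:

> **Corollary 3.31** (M. Christandl, P. Vrana, J. Zuiddam, *Universal points in the asymptotic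
> spectrum of tensors*, J. Amer. Math. Soc. 36 (2023) 31–79 = arXiv:1709.07851v3, p. 16). Let
> `θ ∈ P_s(B)`. Then `F^θ = F_θ` is a point in the asymptotic spectrum `Δ(T)`, a universal spectral
> point.

For 3-tensors (`k = 3`) one has `P_s(B) = P([3])`, the whole probability simplex on `Fin 3`; the
tree's `quantumFunctionalPoint θ` is the lower functional `F_θ` (Def. 3.16) packaged as a function on
`Tensor3 ℂ`, and `asymptoticSpectrum ℂ` is the set of universal spectral points
(`IsUniversalSpectralPoint`: additive under `⊕`, multiplicative under `⊗`, normalised, restriction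
monotone, nonnegative).

The printed proof is "Cor. 3.31 = Thm. 3.5 (2), (3) for the upper functional `F^θ` + Thm. 3.19 for the
lower functional `F_θ` + Thm. 3.30 (`F^θ = F_θ`)". In the tree this is the reduction
`ChristandlVranaZuiddam2023_mem_asymptoticSpectrum_of_upper` (`QuantumFunctionalPointProofs.lean`,
which already contains Thm. 3.19 and the restriction monotonicity unconditionally) fed with the three
discharged deep ingredients:

* Lemma 3.11, sub-additivity of `F^θ`: `ChristandlVranaZuiddam2023_upper_subadditive_holds`
  (`QuantumFunctionalsDirectSumSubadditive.lean`);
* Lemma 3.13, sub-multiplicativity of `F^θ`: `ChristandlVranaZuiddam2023_upper_submultiplicative_holds`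
  (`QuantumFunctionalsUpperSubmultiplicativeProofs.lean`);
* Thm. 3.30, `E^θ = E_θ` (Keyl–Werner spectrum estimation, Thm. 3.24, and the entanglement-polytope
  direction, Thm. 3.29): `ChristandlVranaZuiddam2023_upper_eq_lower_holds`
  (`QuantumFunctionalsUpperEqLower.lean`).

Main results: `ChristandlVranaZuiddam2023_mem_asymptoticSpectrum_holds` (the discharge),
`quantumFunctionalPoint_mem_asymptoticSpectrum` (pointwise form) and
`isUniversalSpectralPoint_quantumFunctionalPoint` (unbundled form). No definitions, no named facts.

## Source

M. Christandl, P. Vrana, J. Zuiddam, J. Amer. Math. Soc. 36 (2023) 31–79 = arXiv:1709.07851v3, §3.4,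
Cor. 3.31 (with Thm. 3.5, Lemma 3.11, Lemma 3.13, Thm. 3.19, Thm. 3.24, Thm. 3.29, Thm. 3.30).
[ChristandlVranaZuiddam2023]
-/

noncomputable section

namespace Literature.Computability.AlgebraicComplexity

/-- **Discharge of `ChristandlVranaZuiddam2023_mem_asymptoticSpectrum` (CVZ Cor. 3.31)**: for every
`θ` in the probability simplex on `Fin 3` (`= P_s(B)` for `k = 3`), the quantum functional
`F^θ = F_θ` is a universal spectral point, i.e. `quantumFunctionalPoint θ ∈ asymptoticSpectrum ℂ` —
by the printed proof: Lemma 3.11 and Lemma 3.13 for the upper functional, Thm. 3.19 for the lower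
functional, and Thm. 3.30 identifying the two. [cite: ChristandlVranaZuiddam2023, Cor. 3.31] -/
theorem ChristandlVranaZuiddam2023_mem_asymptoticSpectrum_holds :
    ChristandlVranaZuiddam2023_mem_asymptoticSpectrum :=
  ChristandlVranaZuiddam2023_mem_asymptoticSpectrum_of_upper
    ChristandlVranaZuiddam2023_upper_subadditive_holds
    ChristandlVranaZuiddam2023_upper_submultiplicative_holds
    ChristandlVranaZuiddam2023_upper_eq_lower_holds

/-- **CVZ Cor. 3.31, pointwise**: `F_θ ∈ Δ(T)` for `θ ∈ P([3])`.
[cite: ChristandlVranaZuiddam2023, Cor. 3.31] -/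
theorem quantumFunctionalPoint_mem_asymptoticSpectrum {θ : Fin 3 → ℝ} (hθ : θ ∈ stdSimplex ℝ (Fin 3)) :
    quantumFunctionalPoint θ ∈ asymptoticSpectrum ℂ :=
  ChristandlVranaZuiddam2023_mem_asymptoticSpectrum_holds θ hθ

/-- **CVZ Cor. 3.31, unbundled**: `F_θ` is a universal spectral point over `ℂ` (additive under `⊕`,
multiplicative under `⊗`, `F_θ(⟨1⟩) = 1`, restriction monotone, nonnegative) for `θ ∈ P([3])`.
[cite: ChristandlVranaZuiddam2023, Cor. 3.31] -/
theorem isUniversalSpectralPoint_quantumFunctionalPoint {θ : Fin 3 → ℝ}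
    (hθ : θ ∈ stdSimplex ℝ (Fin 3)) : IsUniversalSpectralPoint ℂ (quantumFunctionalPoint θ) :=
  quantumFunctionalPoint_mem_asymptoticSpectrum hθ

end Literature.Computability.AlgebraicComplexity

end
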